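import Summits.Ventures.DiscreteObjects.Hadamard.CompositeOrderTable

/-!
# Hadamard 668 census, family F12 — rank-2 elementary abelian groups `C_p × C_p` of signed automorphisms: the action
# and Burnside's divisibility (kernel tools)

Framing: lottery ticket; floor = certified bounds/negative ranges.

Cell pub-namedobj (venture DiscreteObjects), target (H), hadamard gen 16.  Family F12 so far treated CYCLIC subgroups
(prime, composite and prime-square orders) and the Frobenius groups `Z_p ⋊ Z_d`.  This file sets up the NON-CYCLIC
`p`-subgroups of rank 2: two signed-permutation automorphisms `(α, α', d₁, e₁)`, `(β, β', d₂, e₂)` of a `±1` matrix `H`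
whose permutation parts commute and satisfy `α^p = β^p = 1` give, for every `g = (a, b) ∈ (ℤ/p)²`
(`Multiplicative (ZMod p × ZMod p)`), the permutation `α^a β^b` — written out as
`α ^ (toAdd g).1.val * β ^ (toAdd g).2.val` throughout (no definitions, so that the file stays in the proof lane) —
which is multiplicative in `g` (`pairPerm_mul`), has `p`-th power `1` (`pairPerm_pow_p`), and is the permutation part of
a signed automorphism (`isSignedAut_pair`, via `isSignedAut_mul` and the tree's `isSignedAut_pow`).  **Burnside's lemma**
(Mathlib `MulAction.sum_card_fixedBy_eq_card_orbits_mul_card_group`, for the action through the homomorphism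
`g ↦ α^a β^b`) gives `p² ∣ Σ_g #Fix(α^a β^b)` (`sq_dvd_sum_card_fixed_pair`).  INDEPENDENCE of `α, β` is the hypothesis
`∀ a b < p, α^a β^b = 1 → a = b = 0` (i.e. `⟨α, β⟩ ≅ C_p × C_p`), under which `α^a β^b ≠ 1` for `g ≠ 1`
(`pairPerm_ne_one`).  Also: fixed points of `σ^k`, `0 < k < p`, are those of `σ` (`fixed_pow_eq`).  Used by
`ElemAbelianRank2Large668` (p ∈ {13, 37, 41, 83, 167}) and `ElemAbelianRank2_23`.  Ours, not literature; no `sorry`.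
-/

namespace Summit.Ventures.DiscreteObjects.Hadamard

open Finset BigOperators

variable {ι : Type*} [Fintype ι] [DecidableEq ι]

section pair
variable (p : ℕ) [hp : Fact p.Prime] (α β : Equiv.Perm ι)

omit [Fintype ι] [DecidableEq ι] in
/-- `α^a β^b · α^c β^d = α^(a+c) β^(b+d)` for commuting `α, β` of exponent `p` -/
lemma pairPerm_mul (hα : α ^ p = 1) (hβ : β ^ p = 1) (hc : Commute α β)
    (g h : Multiplicative (ZMod p × ZMod p)) :
    α ^ (Multiplicative.toAdd (g * h)).1.val * β ^ (Multiplicative.toAdd (g * h)).2.val =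
      (α ^ (Multiplicative.toAdd g).1.val * β ^ (Multiplicative.toAdd g).2.val) *
      (α ^ (Multiplicative.toAdd h).1.val * β ^ (Multiplicative.toAdd h).2.val) := by
  haveI : NeZero p := ⟨hp.out.ne_zero⟩
  rw [toAdd_mul, Prod.fst_add, Prod.snd_add, ZMod.val_add, ZMod.val_add, ← pow_eq_pow_mod _ hα,
    ← pow_eq_pow_mod _ hβ, pow_add, pow_add]
  set a := (Multiplicative.toAdd g).1.val
  set b := (Multiplicative.toAdd g).2.val
  set c := (Multiplicative.toAdd h).1.val
  set e := (Multiplicative.toAdd h).2.val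
  calc α ^ a * α ^ c * (β ^ b * β ^ e) = α ^ a * (α ^ c * β ^ b) * β ^ e := by simp only [mul_assoc]
    _ = α ^ a * (β ^ b * α ^ c) * β ^ e := by rw [(hc.pow_pow c b).eq]
    _ = α ^ a * β ^ b * (α ^ c * β ^ e) := by simp only [mul_assoc]

omit [Fintype ι] [DecidableEq ι] in
/-- every element of `(ℤ/p)²` has `g^p = 1` -/
lemma pair_pow_p (g : Multiplicative (ZMod p × ZMod p)) : g ^ p = 1 := by
  rw [← ofAdd_toAdd g, ← ofAdd_nsmul]
  simp [nsmul_eq_mul, Prod.ext_iff]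

omit [Fintype ι] [DecidableEq ι] in
/-- **the homomorphism** `g ↦ α^a β^b` exists (we only record its consequences, to avoid a definition):
powers go to powers -/
lemma pairPerm_pow (hα : α ^ p = 1) (hβ : β ^ p = 1) (hc : Commute α β)
    (g : Multiplicative (ZMod p × ZMod p)) (k : ℕ) :
    α ^ (Multiplicative.toAdd (g ^ k)).1.val * β ^ (Multiplicative.toAdd (g ^ k)).2.val =
      (α ^ (Multiplicative.toAdd g).1.val * β ^ (Multiplicative.toAdd g).2.val) ^ k := by
  induction k with
  | zero => simp
  | succ k ih => rw [pow_succ, pairPerm_mul p α β hα hβ hc, ih, pow_succ]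

omit [Fintype ι] [DecidableEq ι] in
/-- hence `(α^a β^b)^p = 1` -/
lemma pairPerm_pow_p (hα : α ^ p = 1) (hβ : β ^ p = 1) (hc : Commute α β)
    (g : Multiplicative (ZMod p × ZMod p)) :
    (α ^ (Multiplicative.toAdd g).1.val * β ^ (Multiplicative.toAdd g).2.val) ^ p = 1 := by
  rw [← pairPerm_pow p α β hα hβ hc, pair_pow_p]
  simp

omit [Fintype ι] [DecidableEq ι] in
/-- two pair permutations commute -/
lemma pairPerm_commute (hα : α ^ p = 1) (hβ : β ^ p = 1) (hc : Commute α β)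
    (g h : Multiplicative (ZMod p × ZMod p)) :
    Commute (α ^ (Multiplicative.toAdd g).1.val * β ^ (Multiplicative.toAdd g).2.val)
      (α ^ (Multiplicative.toAdd h).1.val * β ^ (Multiplicative.toAdd h).2.val) := by
  show _ * _ = _ * _
  rw [← pairPerm_mul p α β hα hβ hc, ← pairPerm_mul p α β hα hβ hc, mul_comm]

omit [Fintype ι] [DecidableEq ι] in
/-- **independence**: if `α^a β^b = 1` only for `a = b = 0` (`a, b < p`), then `α^a β^b ≠ 1` for `g ≠ 1` -/
lemma pairPerm_ne_one (hind : ∀ a b : ℕ, a < p → b < p → α ^ a * β ^ b = 1 → a = 0 ∧ b = 0)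
    {g : Multiplicative (ZMod p × ZMod p)} (hg : g ≠ 1) :
    α ^ (Multiplicative.toAdd g).1.val * β ^ (Multiplicative.toAdd g).2.val ≠ 1 := by
  haveI : NeZero p := ⟨hp.out.ne_zero⟩
  intro h
  apply hg
  obtain ⟨h1, h2⟩ := hind _ _ (ZMod.val_lt _) (ZMod.val_lt _) h
  rw [ZMod.val_eq_zero] at h1 h2
  rw [← ofAdd_toAdd g]
  have : Multiplicative.toAdd g = 0 := Prod.ext h1 h2
  rw [this]; rfl

/-- **Burnside divisibility.**  For commuting `α, β` of exponent `p`: `p² ∣ Σ_{g ∈ (ℤ/p)²} #Fix(α^a β^b)` (Burnside's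
lemma for the action of `(ℤ/p)²` through `g ↦ α^a β^b`: the sum is `|G| ·` number of orbits). -/
theorem sq_dvd_sum_card_fixed_pair (hα : α ^ p = 1) (hβ : β ^ p = 1) (hc : Commute α β) :
    p ^ 2 ∣ ∑ g : Multiplicative (ZMod p × ZMod p),
      (univ.filter fun i => (α ^ (Multiplicative.toAdd g).1.val * β ^ (Multiplicative.toAdd g).2.val) i = i).card := by
  classical
  let φ : Multiplicative (ZMod p × ZMod p) →* Equiv.Perm ι :=
    { toFun := fun g => α ^ (Multiplicative.toAdd g).1.val * β ^ (Multiplicative.toAdd g).2.val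
      map_one' := by simp
      map_mul' := pairPerm_mul p α β hα hβ hc }
  letI : MulAction (Multiplicative (ZMod p × ZMod p)) ι := MulAction.compHom ι φ
  have hB := MulAction.sum_card_fixedBy_eq_card_orbits_mul_card_group (Multiplicative (ZMod p × ZMod p)) ι
  have hcardG : Fintype.card (Multiplicative (ZMod p × ZMod p)) = p ^ 2 := by
    rw [Fintype.card_multiplicative, Fintype.card_prod, ZMod.card, sq]
  have hfix : ∀ g : Multiplicative (ZMod p × ZMod p), Fintype.card (MulAction.fixedBy ι g) =
      (univ.filter fun i => (α ^ (Multiplicative.toAdd g).1.val * β ^ (Multiplicative.toAdd g).2.val) i = i).card := by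
    intro g
    refine Fintype.card_of_subtype _ (fun i => ?_)
    rw [Finset.mem_filter, MulAction.mem_fixedBy]
    simp only [Finset.mem_univ, true_and]
    rfl
  refine ⟨Fintype.card (MulAction.orbitRel.Quotient (Multiplicative (ZMod p × ZMod p)) ι), ?_⟩
  rw [← hcardG, mul_comm, ← hB]
  exact Finset.sum_congr rfl (fun g _ => (hfix g).symm)

/-- fixed points of a power contain the fixed points -/
lemma fixed_subset_fixed_pow (σ : Equiv.Perm ι) (k : ℕ) :
    (univ.filter fun i => σ i = i) ⊆ (univ.filter fun i => (σ ^ k) i = i) := by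
  intro i hi
  simp only [Finset.mem_filter, Finset.mem_univ, true_and] at hi ⊢
  induction k with
  | zero => simp
  | succ k ih => rw [pow_succ, Equiv.Perm.mul_apply, hi, ih]

omit [Fintype ι] [DecidableEq ι] in
/-- a point fixed by `σ^m` with `0 < m < p` and `σ^p = 1` (`p` prime) is fixed by `σ` -/
lemma fixed_of_pow_fixed (σ : Equiv.Perm ι) (hσ : σ ^ p = 1) {m : ℕ} (hm0 : 0 < m) (hmp : m < p) {i : ι}
    (hi : (σ ^ m) i = i) : σ i = i := by
  have hcop : Nat.Coprime m p :=
    Nat.Coprime.symm ((Nat.Prime.coprime_iff_not_dvd hp.out).2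
      (fun h => absurd (Nat.le_of_dvd hm0 h) (not_le.2 hmp)))
  obtain ⟨u, -, hu⟩ := Nat.exists_mul_mod_eq_one_of_coprime hcop hp.out.one_lt
  have hfix : ∀ n : ℕ, ((σ ^ m) ^ n) i = i := by
    intro n
    induction n with
    | zero => simp
    | succ n ih => rw [pow_succ, Equiv.Perm.mul_apply, hi, ih]
  have h := hfix u
  rw [← pow_mul, pow_eq_pow_mod _ hσ, hu, pow_one] at h
  exact h

/-- for `0 < k < p` the fixed points of `σ^k` are exactly those of `σ` (`σ^p = 1`) -/
lemma fixed_pow_eq (σ : Equiv.Perm ι) (hσ : σ ^ p = 1) {k : ℕ} (hk0 : 0 < k) (hkp : k < p) :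
    (univ.filter fun i => (σ ^ k) i = i) = (univ.filter fun i => σ i = i) := by
  apply Finset.Subset.antisymm
  · intro i hi
    simp only [Finset.mem_filter, Finset.mem_univ, true_and] at hi ⊢
    exact fixed_of_pow_fixed p σ hσ hk0 hkp hi
  · exact fixed_subset_fixed_pow σ k

end pair

section signed
variable {H : Matrix ι ι ℤ}

omit [Fintype ι] [DecidableEq ι] in
/-- the composite of two signed automorphisms is a signed automorphism -/
lemma isSignedAut_mul {π₁ κ₁ π₂ κ₂ : Equiv.Perm ι} {d₁ e₁ d₂ e₂ : ι → ℤ}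
    (h₁ : IsSignedAut H π₁ κ₁ d₁ e₁) (h₂ : IsSignedAut H π₂ κ₂ d₂ e₂) :
    IsSignedAut H (π₁ * π₂) (κ₁ * κ₂) (fun i => d₁ (π₂ i) * d₂ i) (fun j => e₁ (κ₂ j) * e₂ j) := by
  refine ⟨fun i => ?_, fun j => ?_, fun i j => ?_⟩
  · rcases h₁.1 (π₂ i) with h | h <;> rcases h₂.1 i with h' | h' <;> simp [h, h']
  · rcases h₁.2.1 (κ₂ j) with h | h <;> rcases h₂.2.1 j with h' | h' <;> simp [h, h']
  · rw [Equiv.Perm.mul_apply, Equiv.Perm.mul_apply, h₁.2.2, h₂.2.2]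
    ring

omit [Fintype ι] [DecidableEq ι] in
/-- **the signed automorphism attached to `g = (a, b)`**: permutation parts `α^a β^b`, `α'^a β'^b` (some signs) -/
lemma isSignedAut_pair (p : ℕ) {α α' β β' : Equiv.Perm ι} {d₁ e₁ d₂ e₂ : ι → ℤ}
    (hA : IsSignedAut H α α' d₁ e₁) (hB : IsSignedAut H β β' d₂ e₂) (g : Multiplicative (ZMod p × ZMod p)) :
    ∃ d e : ι → ℤ, IsSignedAut H (α ^ (Multiplicative.toAdd g).1.val * β ^ (Multiplicative.toAdd g).2.val)
      (α' ^ (Multiplicative.toAdd g).1.val * β' ^ (Multiplicative.toAdd g).2.val) d e :=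
  ⟨_, _, isSignedAut_mul (isSignedAut_pow hA _) (isSignedAut_pow hB _)⟩

end signed

end Summit.Ventures.DiscreteObjects.Hadamard
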